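import Summits.RiemannHypothesis.RiemannHypothesis.Theorems.TiltedLandingLaw421R3Lens1CoverageR
import Summits.RiemannHypothesis.RiemannHypothesis.Theorems.TiltedLandingLaw421R3RateSplit
import Summits.RiemannHypothesis.RiemannHypothesis.Theses.EarlyAppointments

/-! # trkD_v7q (half) — UPGRADE DRAFT-7b (director-rh g23 (CA473)/(CA474)) — skeleton for `TiltedLandingLaw421R` at `halfPurse`: the SUCC law of record
`RhW08.LandingDoor.DoorAvailLawQ8` replaced by ONE CELL-FREE RESIDUAL STUB IN SUCCESSOR CURRENCY `RhW08.Lens1Coverage.RegRes8S` (lens-1 module R-v3 5e4f5aaf, design of record (CA463)(a) + (CA473)(4)):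
`RegRes8S := SUCC binders → f⁽ʲ⁺¹⁾ v ≠ 0 → ¬CellF → ¬CellNb → ¬LandingDipDeep → ¬LandingDipW → ¬IsolatedNewtonL → ∃ u, StTrkDQ … (j+1) u` — i.e. a successor is asked ONLY on configurations
outside the five PROVED regimes F / N♭ / L-deep / L-weighted-cone (`regime_LW`, weighted Jensen dip) / E-isolated-lateral (`regime_EisoL`, one-body upper-model with free (c, ρ, K) and
the level-(j+1) window taken pointwise on the disc); monotone by name: `regRes8S_of_regRes8` (door ⇒ successor), `regRes8S_of_doorAvailLawQ8` (weaker than the law of record) and `regRes8S_of_regimes5 : RegCov8 → RegLfarW8 → RegEres8 → RegRes8S`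
(weaker than the DRAFT-6b triple; «successor exists but no door» frames such as the (CA473) edge double-pair corners cannot kill it); RATE stub unchanged (`RhW08.RateSplit.RateLawsHalfQ`, #1112).
INTERFACE (lens-1 module R, accepted (CA472)): module `…/Theorems/TiltedLandingLaw421R3Lens1CoverageR.lean` (R-v3 5e4f5aaf, imports `…R3Lens1CoverageW`; 0 sorry) declaring
`IsolatedNewtonL`, `isolatedNewtonL_of_isolatedNewton`, `regime_EisoL`, `def RegRes8 : Prop`, `def RegRes8S : Prop`, `regRes8S_of_regRes8`, `regRes8S_of_doorAvailLawQ8`, `regRes8S_of_regimes5`, `antiEscapeCore_of_resS`, `restSuccBotQ_of_resS` and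
`theorem TiltedLandingLaw421R_of_resS (hX : RegRes8S) (hR : RhW08.RateSplit.RateLawsHalfQ) : Summit.RiemannHypothesis.RiemannHypothesis.Theses.EarlyAppointments.TiltedLandingLaw421R`.
USE RULE (CA464)/(CA473)(3): at registry STEP 2 the lead registers the HIGHEST LANDED rung as `Lines/trkD_v7q.lean`: R landed ⇒ THIS file; W ⇒ DRAFT-6b 77725776; FLOOR = W (never D/C/B: their door-currency L-stub is inhabited-and-doorless at edge double-pair corners, (CA473));
STEP 2 waits for W if needed, never for a rung above the highest landed; later rungs land as `Lines/trkD_v8q.lean`, … -/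

namespace Summit.RiemannHypothesis.RiemannHypothesis.Cruxes.TiltedLandingLaw421R.TrkDV8Q

set_option linter.dupNamespace false

/-- OPEN residual stub (cell-free, SUCCESSOR currency): `RhW08.Lens1Coverage.RegRes8S`. -/
theorem stub_regRes8S : RhW08.Lens1Coverage.RegRes8S := by
  sorry

/-- OPEN (lens-2): the rate laws `RhW08.RateSplit.RateLawsHalfQ`. -/
theorem stub_rateLawsHalfQ : RhW08.RateSplit.RateLawsHalfQ := by
  sorry

/-- The crux BY NAME from the two stubs (`RhW08.Lens1Coverage.TiltedLandingLaw421R_of_resS`). -/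
theorem TiltedLandingLaw421R_of : Summit.RiemannHypothesis.RiemannHypothesis.Theses.EarlyAppointments.TiltedLandingLaw421R :=
  RhW08.Lens1Coverage.TiltedLandingLaw421R_of_resS stub_regRes8S stub_rateLawsHalfQ

end Summit.RiemannHypothesis.RiemannHypothesis.Cruxes.TiltedLandingLaw421R.TrkDV8Q
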